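import Summits.ResolutionOfSingularities.ResolutionOfSingularities.Theorems.PurelyInseparableDim4JointHereditaryModel
import HarnessLib

/-!
# Purely inseparable four-folds: the CHILD of a coordinate member together with its HEREDITARY WAITING REGIONS
# (brick S3 (c) «joint point∘coordinate chains», part 61b = v3-H, the child package; cell `res-dim4-pi`)

[OURS · counted 0] (D-0157 DOOR 2; desk WORD #66 (4)(c), #74 (g), #99 (d); frame `PIDim4.TerminationImpliesOrderReduction`, S3 (c)
v3-H; host item stmt-ResolutionOfSingularities-16155, helper). Nothing here proves resolution of singularities in dimension ≥ 4 /
characteristic `p` — NOT here, not anywhere in this programme.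

Part 12's `kid_package_of_iso` (the child `(j, b, S″)` of a blown-up coordinate member through the shared comparison `ε`: closed,
regular, snc, zigzag chart, shape, model description, over the parent) EXTENDED by the child's hereditary waiting regions: for every
hereditary waiting entry `wt = (j″, c, T)` of the child (`c_j = 0`, `c|_S = 0`, `S ∖ {j} ⊆ T ∋ j` — the region lies inside the new
exceptional divisor over the parent) the CLOSED set `rgn wt = φ″(ψ″⁻¹ V(z, x_T − c_T))` read through the CHILD's OWN zigzag chart
(the clause of `MemberChartZ`, part 60), with: the region is seen (`V(z, x_T − c_T) ⊆ ψ″(Y″)`), lies over the parent, has the model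
description `w ∈ rgn wt ⟺ ι(ε w) ∈ φ₀(V(z, x_T − c_T))`; and — when every old boundary component meeting the parent CONTAINS it
(`idx D ∈ S`) — the model-free boundary invariants of part 60: every new boundary component meeting a region contains child and region,
every new component meeting the child contains it. Closedness: `φ₀(V(z, x_T − c_T))` is the image of `V(z, x_T)` under the chart
re-centred at `b + c` (translation `τ_c` composed with the cleaning), closed by typ-2's criterion (`S ∖ {j} ⊆ T`).

* (model lemmas in part 61a `…JointHereditaryModel`);
* **`child_package_hereditary`**.

AI-produced formalisation, weaker than expert review. bears_on: LADDER-RESOLUTION:D157-DOOR2 (res-dim4-pi · S3 (c) joint v3-H · child package).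
-/

set_option linter.dupNamespace false -- D-0017: single-problem summit path `Summit.<S>.<S>.…` by design

noncomputable section

open MvPolynomial Finset CategoryTheory AlgebraicGeometry Opposite TopologicalSpace
open AlgebraicGeometry.Scheme.IdealSheafData (ofIdealTop vanishingIdeal)

namespace Summit.ResolutionOfSingularities.ResolutionOfSingularities.Theorems.PIDim4

open Literature.AlgebraicGeometry.Resolution
open Literature.AlgebraicGeometry.Resolution.Hauser2010
open Literature.AlgebraicGeometry.Resolution.AffinePointBlowup (P A γ coord Wtop ξ)

namespace Equimultiple

/-! ## The child with its hereditary waiting regions -/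

section ChildH

variable {K : Type} [Field K] {p : ℕ} [hp : Fact p.Prime] [CharP K p] [DecidableEq K]
variable {Z Y W Bl : Scheme.{0}} (φ : Y ⟶ Z) [IsOpenImmersion φ] (ψ : Y ⟶ P 4 K) [IsOpenImmersion ψ]
  {π : W ⟶ Z} {B : Bl ⟶ P 4 K} {S : Finset (Fin 4)}
  (ε : (π ⁻¹ᵁ φ.opensRange : Scheme.{0}) ≅ (B ⁻¹ᵁ ψ.opensRange : Scheme.{0}))

omit hp [CharP K p] [DecidableEq K] [IsOpenImmersion φ] [IsOpenImmersion ψ] in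
/-- **The region re-centred**: for the child's re-centring `Θ` at `b` (`Θ z = z + h(x)`, `Θ xᵢ = xᵢ + bᵢ`) and the translation `τ_c`,
`Θ″ = τ_c ∘ Θ` is a re-centring at `b + c`, reads the chart dictionary with the TRANSLATED child state `G(x + c)`, and carries `V(z, x_T)`
onto `φ₀(V(z, x_T − c_T))`. [cite: StacksProject, Tag 01J7] [cite: Hu2025, §5 Prop. 5.3] -/
theorem recentre_translate (hB : IsBlowup B (AffineCoordBlowup.𝓘Λ 4 K (insert 0 (Fin.succ '' (S : Set (Fin 4))))))
    {j : Fin 4} (hj : j ∈ S) {Θ : A 4 K ≃ₐ[K] A 4 K} {b : Fin 4 → K} (hs : ∀ i : Fin 4, Θ (X i.succ) = X i.succ + C (b i))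
    (J : Bl.IdealSheafData) (G : MvPolynomial (Fin 4) K)
    (hc : J.comap (Spec.map (CommRingCat.ofHom (Θ : A 4 K →+* A 4 K)) ≫
      AffineCoordBlowup.chartImm hB (ChartDictionary.succ_mem_centreVars hj)) = hypSheaf p G)
    (c : Fin 4 → K) (T : Finset (Fin 4)) :
    (∀ i : Fin 4, (Θ.trans (AffinePointBlowup.translateEquiv (n := 4) (Fin.cases 0 c))) (X i.succ) = X i.succ + C (b i + c i)) ∧
    J.comap (Spec.map (CommRingCat.ofHom ((Θ.trans (AffinePointBlowup.translateEquiv (n := 4) (Fin.cases 0 c)) :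
        A 4 K ≃ₐ[K] A 4 K) : A 4 K →+* A 4 K)) ≫ AffineCoordBlowup.chartImm hB (ChartDictionary.succ_mem_centreVars hj)) =
      hypSheaf p (PointBlowup.translate c G) ∧
    (Spec.map (CommRingCat.ofHom ((Θ.trans (AffinePointBlowup.translateEquiv (n := 4) (Fin.cases 0 c)) :
        A 4 K ≃ₐ[K] A 4 K) : A 4 K →+* A 4 K)) ≫ AffineCoordBlowup.chartImm hB (ChartDictionary.succ_mem_centreVars hj)) ''
      (AffineCoordBlowup.CΛ 4 K (insert 0 (Fin.succ '' (T : Set (Fin 4)))) : Set (P 4 K)) =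
    (Spec.map (CommRingCat.ofHom (Θ : A 4 K →+* A 4 K)) ≫ AffineCoordBlowup.chartImm hB (ChartDictionary.succ_mem_centreVars hj)) ''
      {x : P 4 K | (X 0 : A 4 K) ∈ x.asIdeal ∧ ∀ i ∈ T, (X i.succ - C (c i) : A 4 K) ∈ x.asIdeal} := by
  set τ : A 4 K ≃ₐ[K] A 4 K := AffinePointBlowup.translateEquiv (n := 4) (Fin.cases 0 c) with hτ
  have hτX : ∀ k : Fin (4 + 1), τ (X k) = X k + C (Fin.cases (0 : K) c k) := fun k =>
    AffinePointBlowup.translateEquiv_X _ k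
  have hτC : ∀ r : K, τ (C r) = C r := fun r => τ.commutes r
  have hcomp : Spec.map (CommRingCat.ofHom ((Θ.trans τ : A 4 K ≃ₐ[K] A 4 K) : A 4 K →+* A 4 K)) =
      Spec.map (CommRingCat.ofHom (τ : A 4 K →+* A 4 K)) ≫ Spec.map (CommRingCat.ofHom (Θ : A 4 K →+* A 4 K)) := by
    rw [← Spec.map_comp, ← CommRingCat.ofHom_comp]
    rfl
  refine ⟨fun i => ?_, ?_, ?_⟩
  · rw [AlgEquiv.trans_apply, hs, map_add, hτX, Fin.cases_succ, hτC, add_assoc, ← C_add, add_comm (c i)]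
  · have hτhyp : (τ : A 4 K →+* A 4 K) (hyp p G) = hyp p (PointBlowup.translate c G) := by
      have hG : (τ : A 4 K →ₐ[K] A 4 K).comp (rename Fin.succ) =
          (rename Fin.succ).comp (aeval fun i => (X i + C (c i) : MvPolynomial (Fin 4) K)) := by
        refine MvPolynomial.algHom_ext fun i => ?_
        simp only [AlgHom.comp_apply, rename_X, aeval_X, map_add, rename_C]
        change τ (X i.succ) = _
        rw [hτX, Fin.cases_succ]
      have hG' := DFunLike.congr_fun hG G
      change τ (hyp p G) = _
      rw [hyp, hyp, map_add, map_pow, hτX, Fin.cases_zero, C_0, add_zero, PointBlowup.translate]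
      exact congrArg _ hG'
    rw [hcomp, Category.assoc, Scheme.IdealSheafData.comap_comp, hc, ChartDictionary.comap_hypSheaf_specMap, hτhyp, hypSheaf]
  · rw [hcomp, Category.assoc, Scheme.Hom.comp_base, TopCat.coe_comp, Set.image_comp, image_specMap_translate_CΛ]

/-- **THE CHILD WITH ITS HEREDITARY WAITING REGIONS** (part 12's `kid_package_of_iso` + the regions of part 60's `MemberChartZ`).
Setting of part 12. In addition, for every hereditary waiting entry `wt = (j″, c, T) ∈ Ht` of the child (`c_j = 0`, `c|_S = 0`,
`S ∖ {j} ⊆ T ∋ j`): a closed `rgn wt ⊆ W` with `rgn wt = φ″(ψ″⁻¹ V(z, x_T − c_T))` for the child's OWN zigzag chart, seen, over the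
parent, with a model description; and if every old boundary component meeting the parent contains it (`idx D ∈ S`), every new
component meeting the child contains it and every new component meeting a region contains child and region.
[cite: BierstoneGrigorievMilmanWlodarczyk2011, Def. 3.1.3 (1)–(2), (4)] [cite: GortzWedhorn2020, Prop. 13.91] [cite: Hauser2010, §G] -/
theorem child_package_hereditary [IsLocallyNoetherian Z] [IsAlgClosed K] (Zc : Z.IdealSheafData)
    (hπ : IsBlowup π Zc) (hB : IsBlowup B (AffineCoordBlowup.𝓘Λ 4 K (insert 0 (Fin.succ '' (S : Set (Fin 4))))))
    (hsq : ε.hom ≫ (B ∣_ ψ.opensRange) = (π ∣_ φ.opensRange) ≫ (φ.isoOpensRange.inv ≫ ψ.isoOpensRange.hom))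
    (hC' : ((AffineCoordBlowup.𝓘Λ 4 K (insert 0 (Fin.succ '' (S : Set (Fin 4))))).comap ψ.opensRange.ι).comap
        (φ.isoOpensRange.inv ≫ ψ.isoOpensRange.hom) = Zc.comap φ.opensRange.ι)
    (M : MarkedIdeal Z) (hmult : M.mult = p) (s : State K)
    (hKEY : ((controlledTransform B (AffineCoordBlowup.𝓘Λ 4 K (insert 0 (Fin.succ '' (S : Set (Fin 4)))))
        (hypSheaf p s.F) p).comap (B ⁻¹ᵁ ψ.opensRange).ι).comap ε.hom =
      (controlledTransform π Zc M.ideal p).comap (π ⁻¹ᵁ φ.opensRange).ι)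
    (hperm : (p : ℕ∞) ≤ CentreBlowup.ordAlong S s.F)
    (hsee : (AffineCoordBlowup.CΛ 4 K (insert 0 (Fin.succ '' (S : Set (Fin 4)))) : Set (P 4 K)) ⊆ Set.range ψ)
    (hT : IsClosed (φ '' (ψ ⁻¹' (AffineCoordBlowup.CΛ 4 K (insert 0 (Fin.succ '' (S : Set (Fin 4)))) : Set (P 4 K)))))
    (hsncZ : HasSNCWith M.boundary Zc) (idx : Z.IdealSheafData → Fin 4) (cst : Z.IdealSheafData → K)
    (hshape : ∀ D ∈ M.boundary, ((D.support : Set Z) ∩ φ '' (ψ ⁻¹' (AffineCoordBlowup.CΛ 4 K (insert 0 (Fin.succ '' (S : Set (Fin 4)))) : Set (P 4 K)))).Nonempty →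
      D.comap φ = (ofIdealTop (Ideal.span {(γ 4 K).symm (X (idx D).succ + C (cst D))})).comap ψ ∧
        (idx D ∈ S → cst D = 0))
    (hinj : ∀ D₁ ∈ M.boundary, ∀ D₂ ∈ M.boundary,
      ((D₁.support : Set Z) ∩ φ '' (ψ ⁻¹' (AffineCoordBlowup.CΛ 4 K (insert 0 (Fin.succ '' (S : Set (Fin 4)))) : Set (P 4 K)))).Nonempty → ((D₂.support : Set Z) ∩ φ '' (ψ ⁻¹' (AffineCoordBlowup.CΛ 4 K (insert 0 (Fin.succ '' (S : Set (Fin 4)))) : Set (P 4 K)))).Nonempty →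
      idx D₁ = idx D₂ → D₁ = D₂)
    {j : Fin 4} (hj : j ∈ S) {b : Fin 4 → K} (hbj : b j = 0) {S'' : Finset (Fin 4)} (hsub : S ⊆ S'')
    (Ht : Finset (Fin 4 × (Fin 4 → K) × Finset (Fin 4)))
    (hHt : ∀ wt ∈ Ht, wt.2.1 j = 0 ∧ (∀ i ∈ S, wt.2.1 i = 0) ∧ S.erase j ⊆ wt.2.2 ∧ j ∈ wt.2.2) :
    ∃ (c'' : Closeds W) (Θ : A 4 K ≃ₐ[K] A 4 K) (rgn : Fin 4 × (Fin 4 → K) × Finset (Fin 4) → Closeds W),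
      (∀ i : Fin 4, Θ (X i.succ) = X i.succ + C (b i)) ∧
      (controlledTransform B (AffineCoordBlowup.𝓘Λ 4 K (insert 0 (Fin.succ '' (S : Set (Fin 4))))) (hypSheaf p s.F) p).comap
          (Spec.map (CommRingCat.ofHom (Θ : A 4 K →+* A 4 K)) ≫
            AffineCoordBlowup.chartImm hB (ChartDictionary.succ_mem_centreVars hj)) =
        hypSheaf p (CentreBlowup.step p S j b s).F ∧
      (∀ (w : W) (hwV : w ∈ π ⁻¹ᵁ φ.opensRange), w ∈ (c'' : Set W) ↔
        ((B ⁻¹ᵁ ψ.opensRange).ι (ε.hom ⟨w, hwV⟩) : Bl) ∈ (Spec.map (CommRingCat.ofHom (Θ : A 4 K →+* A 4 K)) ≫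
            AffineCoordBlowup.chartImm hB (ChartDictionary.succ_mem_centreVars hj)) '' (AffineCoordBlowup.CΛ 4 K (insert 0 (Fin.succ '' (S'' : Set (Fin 4)))) : Set (P 4 K))) ∧
      (c'' : Set W) ⊆ π ⁻¹' (φ '' (ψ ⁻¹' (AffineCoordBlowup.CΛ 4 K (insert 0 (Fin.succ '' (S : Set (Fin 4)))) : Set (P 4 K)))) ∧
      (c'' : Set W).Nonempty ∧
      Scheme.IsRegular (vanishingIdeal c'').subscheme ∧
      HasSNCWith (M.transform π Zc).boundary (vanishingIdeal c'') ∧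
      (∀ wt ∈ Ht,
        (∀ (w : W) (hwV : w ∈ π ⁻¹ᵁ φ.opensRange), w ∈ (rgn wt : Set W) ↔
          ((B ⁻¹ᵁ ψ.opensRange).ι (ε.hom ⟨w, hwV⟩) : Bl) ∈
            (Spec.map (CommRingCat.ofHom ((Θ.trans (AffinePointBlowup.translateEquiv (n := 4) (Fin.cases 0 wt.2.1)) :
                A 4 K ≃ₐ[K] A 4 K) : A 4 K →+* A 4 K)) ≫
              AffineCoordBlowup.chartImm hB (ChartDictionary.succ_mem_centreVars hj)) ''
              (AffineCoordBlowup.CΛ 4 K (insert 0 (Fin.succ '' (wt.2.2 : Set (Fin 4)))) : Set (P 4 K))) ∧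
        (∀ i : Fin 4, (Θ.trans (AffinePointBlowup.translateEquiv (n := 4) (Fin.cases 0 wt.2.1))) (X i.succ) =
          X i.succ + C (b i + wt.2.1 i)) ∧
        (controlledTransform B (AffineCoordBlowup.𝓘Λ 4 K (insert 0 (Fin.succ '' (S : Set (Fin 4))))) (hypSheaf p s.F) p).comap
            (Spec.map (CommRingCat.ofHom ((Θ.trans (AffinePointBlowup.translateEquiv (n := 4) (Fin.cases 0 wt.2.1)) :
                A 4 K ≃ₐ[K] A 4 K) : A 4 K →+* A 4 K)) ≫
              AffineCoordBlowup.chartImm hB (ChartDictionary.succ_mem_centreVars hj)) =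
          hypSheaf p (PointBlowup.translate wt.2.1 (CentreBlowup.step p S j b s).F) ∧
        (rgn wt : Set W) ⊆ π ⁻¹' (φ '' (ψ ⁻¹' (AffineCoordBlowup.CΛ 4 K (insert 0 (Fin.succ '' (S : Set (Fin 4)))) : Set (P 4 K))))) ∧
      ((∀ D ∈ M.boundary, ((D.support : Set Z) ∩ φ '' (ψ ⁻¹' (AffineCoordBlowup.CΛ 4 K (insert 0 (Fin.succ '' (S : Set (Fin 4)))) : Set (P 4 K)))).Nonempty → idx D ∈ S) →
        (∀ D₂ ∈ (M.transform π Zc).boundary, ((D₂.support : Set W) ∩ (c'' : Set W)).Nonempty →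
          (c'' : Set W) ⊆ D₂.support) ∧
        (∀ wt ∈ Ht, ∀ D₂ ∈ (M.transform π Zc).boundary,
          Disjoint (D₂.support : Set W) (rgn wt : Set W) ∨ ((c'' : Set W) ⊆ D₂.support ∧ (rgn wt : Set W) ⊆ D₂.support))) ∧
      ∃ (Y'' : Scheme.{0}) (φ'' : Y'' ⟶ W) (ψ'' : Y'' ⟶ P 4 K) (_ : IsOpenImmersion φ'') (_ : IsOpenImmersion ψ''),
        (M.transform π Zc).ideal.comap φ'' = (hypSheaf p (CentreBlowup.step p S j b s).F).comap ψ'' ∧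
        (vanishingIdeal c'').comap φ'' =
          (AffineCoordBlowup.𝓘Λ 4 K (insert 0 (Fin.succ '' (S'' : Set (Fin 4))))).comap ψ'' ∧
        (c'' : Set W) ⊆ Set.range φ'' ∧
        (AffineCoordBlowup.CΛ 4 K (insert 0 (Fin.succ '' (S'' : Set (Fin 4)))) : Set (P 4 K)) ⊆ Set.range ψ'' ∧
        (∃ (idx₂ : W.IdealSheafData → Fin 4) (cst₂ : W.IdealSheafData → K),
          (∀ D₂ ∈ (M.transform π Zc).boundary,
            ((D₂.support : Set W) ∩ φ'' '' (ψ'' ⁻¹' (AffineCoordBlowup.CΛ 4 K (insert 0 (Fin.succ '' (S'' : Set (Fin 4)))) : Set (P 4 K)))).Nonempty →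
            D₂.comap φ'' = (ofIdealTop (Ideal.span {(γ 4 K).symm (X (idx₂ D₂).succ + C (cst₂ D₂))})).comap ψ'' ∧
              (idx₂ D₂ ∈ S'' → cst₂ D₂ = 0)) ∧
          (∀ D₁ ∈ (M.transform π Zc).boundary, ∀ D₂ ∈ (M.transform π Zc).boundary,
            ((D₁.support : Set W) ∩ φ'' '' (ψ'' ⁻¹' (AffineCoordBlowup.CΛ 4 K (insert 0 (Fin.succ '' (S'' : Set (Fin 4)))) : Set (P 4 K)))).Nonempty →
            ((D₂.support : Set W) ∩ φ'' '' (ψ'' ⁻¹' (AffineCoordBlowup.CΛ 4 K (insert 0 (Fin.succ '' (S'' : Set (Fin 4)))) : Set (P 4 K)))).Nonempty →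
            idx₂ D₁ = idx₂ D₂ → D₁ = D₂)) ∧
        ∀ wt ∈ Ht, (rgn wt : Set W) = φ'' '' (ψ'' ⁻¹' {x : P 4 K | (X 0 : A 4 K) ∈ x.asIdeal ∧ ∀ i ∈ wt.2.2, (X i.succ - C (wt.2.1 i) : A 4 K) ∈ x.asIdeal}) ∧ {x : P 4 K | (X 0 : A 4 K) ∈ x.asIdeal ∧ ∀ i ∈ wt.2.2, (X i.succ - C (wt.2.1 i) : A 4 K) ∈ x.asIdeal} ⊆ Set.range ψ'' := by
  classical
  haveI : PerfectRing K p := PerfectRing.ofSurjective K p fun x => IsAlgClosed.exists_pow_nat_eq x hp.out.pos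
  haveI : IsProper π := hπ.isProper
  haveI : IsLocallyNoetherian W := LocallyOfFiniteType.isLocallyNoetherian π
  haveI : IsProper B := hB.isProper
  haveI : IsLocallyNoetherian Bl := LocallyOfFiniteType.isLocallyNoetherian B
  have hK := hKEY
  obtain ⟨Θ, h, h0, hs, hc⟩ := ChartDictionary.controlledTransform_chart_eq_step p hj hbj s hperm hB
  haveI := isOpenImmersion_specMap_algEquiv Θ
  have hsR : ∀ k : Fin 4, (Θ : A 4 K →+* A 4 K) (X k.succ) = X k.succ + C (b k) := fun k => hs k
  obtain ⟨hread, hexc, hnext⟩ :=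
    ChartDictionary.zigzag_chart_of_chart φ ψ M hmult s.F (CentreBlowup.step p S j b s).F Zc hsee hT hB ε hsq hC' hK
      hj hbj h0 hs hc
  obtain ⟨hsee'', hclosed''⟩ := hnext S'' hsub
  set φ₀ : P 4 K ⟶ Bl := (Spec.map (CommRingCat.ofHom (Θ : A 4 K →+* A 4 K)) ≫
            AffineCoordBlowup.chartImm hB (ChartDictionary.succ_mem_centreVars hj)) with hφ₀
  set φ'' := (φ₀ ∣_ (B ⁻¹ᵁ ψ.opensRange)) ≫ ε.inv ≫ (π ⁻¹ᵁ φ.opensRange).ι with hφ''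
  set ψ'' := (φ₀ ⁻¹ᵁ (B ⁻¹ᵁ ψ.opensRange)).ι with hψ''
  haveI : IsOpenImmersion φ₀ := by rw [hφ₀]; infer_instance
  haveI : IsOpenImmersion φ'' := by rw [hφ'']; infer_instance
  set c'' : Closeds W := closureImage φ'' ((((AffineCoordBlowup.𝓘Λ 4 K
    (insert 0 (Fin.succ '' (S'' : Set (Fin 4))))).comap ψ'').support : Set (φ₀ ⁻¹ᵁ (B ⁻¹ᵁ ψ.opensRange)))) with hc''
  have hcoe : (c'' : Set W) = φ'' '' (ψ'' ⁻¹' (AffineCoordBlowup.CΛ 4 K (insert 0 (Fin.succ '' (S'' : Set (Fin 4)))) : Set (P 4 K))) := by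
    rw [hc'', coe_closureImage, ChartDictionary.coe_support_comap_𝓘Λ ψ'', hclosed''.closure_eq]
  obtain ⟨idx₂, cst₂, hshape₂, hinj₂⟩ :=
    ChartDictionary.shapeT_transform_zigzag φ ψ ε Zc hB hsq hC' hj hbj hs hsub idx cst hshape hinj
  have hE₂ : HasSNC (M.transform π Zc).boundary := MarkedIdeal.hasSNC_transform_boundary M hsncZ hπ
  have hEc₂ : HasSNCWith ((M.transform π Zc).boundary.map (·.comap φ''))
      ((AffineCoordBlowup.𝓘Λ 4 K (insert 0 (Fin.succ '' (S'' : Set (Fin 4))))).comap ψ'') :=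
    ChartDictionary.hasSNCWith_comap_of_shapeT_zigzag φ'' ψ'' hE₂ idx₂ cst₂ hshape₂ hinj₂
  have hξ : (ξ 4 K) ∈ AffineCoordBlowup.CΛ 4 K (insert 0 (Fin.succ '' (S'' : Set (Fin 4)))) := by
    rw [AffineCoordBlowup.mem_CΛ_iff']
    intro i _
    exact (mem_originIdeal_iff K (4 + 1)).mpr (constantCoeff_X K i)
  obtain ⟨y₀, hy₀⟩ := hsee'' hξ
  have hover : (c'' : Set W) ⊆ π ⁻¹' (φ '' (ψ ⁻¹' (AffineCoordBlowup.CΛ 4 K (insert 0 (Fin.succ '' (S : Set (Fin 4)))) : Set (P 4 K)))) := by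
    rw [hcoe]
    exact ChartDictionary.image_next_centre_subset_preimage_zigzag φ ψ ε hB hsq hj hbj hs hsub
  -- the hereditary regions: over the parent, seen, closed
  have hTDw : ∀ wt ∈ Ht, ∀ y ∈ {x : P 4 K | (X 0 : A 4 K) ∈ x.asIdeal ∧ ∀ i ∈ wt.2.2, (X i.succ - C (wt.2.1 i) : A 4 K) ∈ x.asIdeal}, B (φ₀ y) ∈ (AffineCoordBlowup.CΛ 4 K (insert 0 (Fin.succ '' (S : Set (Fin 4)))) : Set (P 4 K)) := fun wt hwt y hy => by
    have hyj := hy.2 j (hHt wt hwt).2.2.2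
    rw [(hHt wt hwt).1, C_0, sub_zero] at hyj
    exact chart_apply_mem_CΛ_of_X_mem hB hj hbj hsR hyj
  have hWsee : ∀ wt ∈ Ht, {x : P 4 K | (X 0 : A 4 K) ∈ x.asIdeal ∧ ∀ i ∈ wt.2.2, (X i.succ - C (wt.2.1 i) : A 4 K) ∈ x.asIdeal} ⊆ Set.range ψ'' := fun wt hwt =>
    ChartDictionary.zigzag_transport_range ψ φ₀ _ fun y hy => hsee (hTDw wt hwt y hy)
  have hWcl : ∀ wt ∈ Ht, IsClosed (φ'' '' (ψ'' ⁻¹' {x : P 4 K | (X 0 : A 4 K) ∈ x.asIdeal ∧ ∀ i ∈ wt.2.2, (X i.succ - C (wt.2.1 i) : A 4 K) ∈ x.asIdeal})) := fun wt hwt =>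
    ChartDictionary.zigzag_transport_isClosed φ ψ ε φ₀ hsq _ _
      (isClosed_image_waitingSetZ_chart hB hj hbj h0 hs (hHt wt hwt).1 (hHt wt hwt).2.2.1) hT (hTDw wt hwt)
  set rgn : Fin 4 × (Fin 4 → K) × Finset (Fin 4) → Closeds W := fun wt =>
    ⟨closure (φ'' '' (ψ'' ⁻¹' {x : P 4 K | (X 0 : A 4 K) ∈ x.asIdeal ∧ ∀ i ∈ wt.2.2, (X i.succ - C (wt.2.1 i) : A 4 K) ∈ x.asIdeal})), isClosed_closure⟩ with hrgn
  have hrcoe : ∀ wt ∈ Ht, (rgn wt : Set W) = φ'' '' (ψ'' ⁻¹' {x : P 4 K | (X 0 : A 4 K) ∈ x.asIdeal ∧ ∀ i ∈ wt.2.2, (X i.succ - C (wt.2.1 i) : A 4 K) ∈ x.asIdeal}) := fun wt hwt => by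
    simp only [hrgn]
    exact (hWcl wt hwt).closure_eq
  have hWover : ∀ wt ∈ Ht, (rgn wt : Set W) ⊆ π ⁻¹' (φ '' (ψ ⁻¹' (AffineCoordBlowup.CΛ 4 K (insert 0 (Fin.succ '' (S : Set (Fin 4)))) : Set (P 4 K)))) := fun wt hwt => by
    rw [hrcoe wt hwt]
    rintro _ ⟨y, hy, rfl⟩
    obtain ⟨hπy, hψy⟩ := ChartDictionary.zigzag_transport_π_apply φ ψ ε φ₀ hsq y
    rw [Set.mem_preimage, hπy]
    refine ⟨_, ?_, rfl⟩
    rw [Set.mem_preimage, hψy]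
    exact hTDw wt hwt y.1 hy
  -- boundary: every new component meeting the child or a region contains both (when old components contain the parent)
  have hHBall : (∀ D ∈ M.boundary, ((D.support : Set Z) ∩ φ '' (ψ ⁻¹' (AffineCoordBlowup.CΛ 4 K (insert 0 (Fin.succ '' (S : Set (Fin 4)))) : Set (P 4 K)))).Nonempty → idx D ∈ S) →
      ∀ D₂ ∈ (M.transform π Zc).boundary,
        (((D₂.support : Set W) ∩ (c'' : Set W)).Nonempty ∨ ∃ wt ∈ Ht, ((D₂.support : Set W) ∩ (rgn wt : Set W)).Nonempty) →
        (c'' : Set W) ⊆ D₂.support ∧ ∀ wt ∈ Ht, (rgn wt : Set W) ⊆ D₂.support := by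
    intro hHB D₂ hD₂ hm
    -- a reading `V(xᵢ + e)` with `i ∈ S`, and the consequences
    have key : ∀ (i : Fin 4) (e : K), i ∈ S →
        D₂.comap φ'' = (ofIdealTop (Ideal.span {(γ 4 K).symm (X i.succ + C e)})).comap ψ'' →
        (c'' : Set W) ⊆ D₂.support ∧ ∀ wt ∈ Ht, (rgn wt : Set W) ⊆ D₂.support := by
      intro i e hiS hr
      -- meeting forces `e = 0`
      have he : e = 0 := by
        rcases hm with ⟨w, hw1, hw2⟩ | ⟨wt, hwt, w, hw1, hw2⟩
        · rw [hcoe] at hw2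
          obtain ⟨y, hy, rfl⟩ := hw2
          have h1 : y ∈ (D₂.comap φ'').support := by rw [Scheme.IdealSheafData.support_comap]; exact hw1
          rw [hr, Scheme.IdealSheafData.support_comap] at h1
          have h2 := (mem_support_hyperplane_iff i e _).mp h1
          have h3 : (X i.succ + C (0 : K) : A 4 K) ∈ (ψ'' y).asIdeal := by
            rw [C_0, add_zero]
            exact (AffineCoordBlowup.mem_CΛ_iff' 4 K _ _).mp hy i.succ (ChartDictionary.succ_mem_centreVars (hsub hiS))
          exact eq_of_X_add_C_mem h2 h3
        · rw [hrcoe wt hwt] at hw2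
          obtain ⟨y, hy, rfl⟩ := hw2
          have h1 : y ∈ (D₂.comap φ'').support := by rw [Scheme.IdealSheafData.support_comap]; exact hw1
          rw [hr, Scheme.IdealSheafData.support_comap] at h1
          have h2 := (mem_support_hyperplane_iff i e _).mp h1
          by_cases hij : i = j
          · subst hij
            have h3 : (X i.succ + C (0 : K) : A 4 K) ∈ (ψ'' y).asIdeal := by
              rw [C_0, add_zero]
              have h4 := hy.2 i (hHt wt hwt).2.2.2
              rwa [(hHt wt hwt).1, C_0, sub_zero] at h4
            exact eq_of_X_add_C_mem h2 h3
          · have h3 : (X i.succ + C (0 : K) : A 4 K) ∈ (ψ'' y).asIdeal := by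
              rw [C_0, add_zero]
              have h4 := hy.2 i ((hHt wt hwt).2.2.1 (Finset.mem_erase.mpr ⟨hij, hiS⟩))
              rwa [(hHt wt hwt).2.1 i hiS, C_0, sub_zero] at h4
            exact eq_of_X_add_C_mem h2 h3
      subst he
      refine ⟨?_, fun wt hwt => ?_⟩
      · rw [hcoe]
        refine image_subset_support_of_comap_eq φ'' ψ'' D₂ _ hr _ fun y hy => (mem_support_hyperplane_iff i 0 y).mpr ?_
        rw [C_0, add_zero]
        exact (AffineCoordBlowup.mem_CΛ_iff' 4 K _ _).mp hy i.succ (ChartDictionary.succ_mem_centreVars (hsub hiS))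
      · rw [hrcoe wt hwt]
        refine image_subset_support_of_comap_eq φ'' ψ'' D₂ _ hr _ fun y hy => (mem_support_hyperplane_iff i 0 y).mpr ?_
        rw [C_0, add_zero]
        by_cases hij : i = j
        · subst hij
          have h4 := hy.2 i (hHt wt hwt).2.2.2
          rwa [(hHt wt hwt).1, C_0, sub_zero] at h4
        · have h4 := hy.2 i ((hHt wt hwt).2.2.1 (Finset.mem_erase.mpr ⟨hij, hiS⟩))
          rwa [(hHt wt hwt).2.1 i hiS, C_0, sub_zero] at h4
    change D₂ ∈ M.boundary.map (strictTransformIdeal π Zc) ++ [Zc.comap π] at hD₂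
    rw [List.mem_append, List.mem_map, List.mem_singleton] at hD₂
    rcases hD₂ with ⟨D, hD, rfl⟩ | rfl
    · -- an old component: it meets the parent region, hence contains it (`idx D ∈ S`, `cst D = 0`)
      have hmD : ((D.support : Set Z) ∩ φ '' (ψ ⁻¹' (AffineCoordBlowup.CΛ 4 K (insert 0 (Fin.succ '' (S : Set (Fin 4)))) : Set (P 4 K)))).Nonempty := by
        rcases hm with ⟨w, hw1, hw2⟩ | ⟨wt, hwt, w, hw1, hw2⟩
        · exact ⟨π w, ChartDictionary.support_strictTransformIdeal_subset_preimage π _ D hw1, hover hw2⟩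
        · exact ⟨π w, ChartDictionary.support_strictTransformIdeal_subset_preimage π _ D hw1, hWover wt hwt hw2⟩
      have hiS := hHB D hD hmD
      obtain ⟨hDi, hcst⟩ := hshape D hD hmD
      rw [hcst hiS, C_0, add_zero] at hDi
      have htr := ChartDictionary.zigzag_transport_strictTransform φ ψ ε _ Zc hsq hC' D _ hDi
      by_cases hij : idx D = j
      · -- `V(x_j)` leaves the chart: it cannot meet anything there
        exfalso
        rw [hij] at htr
        have hmodel : (strictTransformIdeal B (AffineCoordBlowup.𝓘Λ 4 K (insert 0 (Fin.succ '' (S : Set (Fin 4)))))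
            (ofIdealTop (Ideal.span {(γ 4 K).symm (X j.succ)}))).comap φ₀ = ⊤ :=
          ChartDictionary.comap_hyperplane_self_chart hj _ hB
        have htop : (strictTransformIdeal π Zc D).comap φ'' = ⊤ := by
          rw [hφ'', ChartDictionary.zigzag_transport_comap φ ψ ε φ₀ _ _ htr, hmodel, Scheme.IdealSheafData.comap_top]
        have hempty : ∀ w ∈ ((strictTransformIdeal π Zc D).support : Set W), w ∉ Set.range φ'' := by
          rintro _ hw1 ⟨y, rfl⟩
          have h1 : y ∈ ((strictTransformIdeal π Zc D).comap φ'').support := by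
            rw [Scheme.IdealSheafData.support_comap]; exact hw1
          rw [htop, Scheme.IdealSheafData.support_top] at h1
          exact h1
        rcases hm with ⟨w, hw1, hw2⟩ | ⟨wt, hwt, w, hw1, hw2⟩
        · rw [hcoe] at hw2
          obtain ⟨y, -, rfl⟩ := hw2
          exact hempty _ hw1 ⟨y, rfl⟩
        · rw [hrcoe wt hwt] at hw2
          obtain ⟨y, -, rfl⟩ := hw2
          exact hempty _ hw1 ⟨y, rfl⟩
      · refine key (idx D) (b (idx D)) hiS ?_
        rw [hφ'', ChartDictionary.zigzag_transport_comap φ ψ ε φ₀ _ _ htr, hψ'']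
        congr 1
        rw [hφ₀]
        exact ChartDictionary.comap_hyperplane_chart hj hij (hsR (idx D)) hB
    · -- the new exceptional component reads `V(x_j)`
      refine key j 0 hj ?_
      rw [C_0, add_zero]
      exact hexc
  refine ⟨c'', Θ, rgn, hs, hc, fun w hwV => ?_, hover, ⟨φ'' y₀, ?_⟩,
    ChartDictionary.isRegular_globalCentre_zigzag φ'' ψ'' hclosed'',
    ChartDictionary.hasSNCWith_globalCentre_zigzag φ'' ψ'' hclosed'' hE₂ hEc₂,
    fun wt hwt => ⟨fun w hwV => ?_, (recentre_translate (p := p) hB hj hs _ _ hc wt.2.1 wt.2.2).1,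
      (recentre_translate (p := p) hB hj hs _ _ hc wt.2.1 wt.2.2).2.1, hWover wt hwt⟩,
    fun hHB => ⟨fun D₂ hD₂ hm => ?_, fun wt hwt D₂ hD₂ => ?_⟩,
    _, φ'', ψ'', inferInstance, inferInstance, hread, by rw [hc'']; exact ChartDictionary.comap_globalCentre_zigzag φ'' ψ'' _,
    by rw [hcoe]; exact Set.image_subset_range _ _, hsee'', ⟨idx₂, cst₂, hshape₂, hinj₂⟩,
    fun wt hwt => ⟨hrcoe wt hwt, hWsee wt hwt⟩⟩
  · rw [hcoe]
    exact mem_image_zigzag_chart_iff φ ψ ε φ₀ _ hwV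
  · rw [hcoe]
    exact ⟨y₀, by rw [Set.mem_preimage, hy₀]; exact hξ, rfl⟩
  · rw [hrcoe wt hwt, (recentre_translate (p := p) hB hj hs _ _ hc wt.2.1 wt.2.2).2.2]
    exact mem_image_zigzag_chart_iff φ ψ ε φ₀ _ hwV
  · exact (hHBall hHB D₂ hD₂ (Or.inl hm)).1
  · by_cases hm : ((D₂.support : Set W) ∩ (rgn wt : Set W)).Nonempty
    · obtain ⟨h1, h2⟩ := hHBall hHB D₂ hD₂ (Or.inr ⟨wt, hwt, hm⟩)
      exact Or.inr ⟨h1, h2 wt hwt⟩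
    · exact Or.inl (Set.disjoint_iff_inter_eq_empty.mpr (Set.not_nonempty_iff_eq_empty.mp hm))

end ChildH

end Equimultiple

end Summit.ResolutionOfSingularities.ResolutionOfSingularities.Theorems.PIDim4

end
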